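/-
Copyright (c) 2026 the pub-hodgecm-mathlib formalisation cell (harness21).  Prover seat hodgecm-mathlib-K2E1-p10 (g5), Track B «K2-LIT», h413 = `stmt-HodgeConjecture-24833`,
R90-TF section S8 «ContSpec-n½», hCONT road C (S8 dealer R90-CS-plan (g3), S8-R182 (B); census `K2/K2E1-p10/g5/CENSUS-C2-TruncatedFamilyExports.K2E1-p10-g5.md`): (C2a) — from the
CORE's letters and output clauses of the `(χ₁, χ₂)` Eisenstein exports of `U(2,1)_{L∕L⁺}`, the truncated continued family `z ↦ [Λ^T Ẽ(z)]` is an `L²(𝔛, μ)`-holomorphic family OFF THE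
POLE SET `P`, for EVERY truncation level `T ≥ 1` — per ball by ★ (C1) `exists_truncatedFamily_cm_three_of_eigen` (operator road), on the tube by ★ (α′), glued; the truncation-level
change is the ONE visible letter `hC3` (K2E1-p16's (C3)).
-/
import Summits.HodgeConjecture.HodgeConjecture.Theorems.K2E1ChiTruncatedFamilyCMThree             -- ★ (C1) (this seat, p863808): `exists_truncatedFamily_cm_three_of_eigen`; brings ★ CLOSER₃'s world (`HX`, B–L operators, the within-glue)
import Summits.HodgeConjecture.HodgeConjecture.Theorems.K2E1ChiEisensteinPairTruncationTubeCMThree  -- ★ (α′) (R90-C133-p02): `exists_toLp_truncation_differentiableOn_pair_cm_three_free`; brings `IsChiSectionPair`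
import Summits.HodgeConjecture.HodgeConjecture.Theorems.K2E1ConvexDiffCountableConnected           -- ★ `isPreconnected_convex_diff_of_countable`, `countable_of_codiscrete`, `one_lt_rank_real_complex`
import Literature.NumberTheory.Automorphic.UnitaryGroupKernelDictionary                             -- ★ `quotientSubgroup_quasiSplit` (`A_G·G(F) = G(F)`)
import Mathlib.Analysis.Analytic.Uniqueness
import Mathlib.Analysis.Complex.CauchyIntegral
import HarnessLib

/-!
# h413 ∕ R90-TF S8 — `K2E1ChiTruncatedFamilyOfCoreLettersCMThree` ((C2a) of the hCONT road): `∀ T ≥ 1, ∃ Fam : ℂ → L²(𝔛, μ), DifferentiableOn ℂ Fam Pᶜ ∧ ∀ z ∉ P,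
# Fam z =ᵐ quotFun (Λ^T (Ẽ z))` FROM THE CORE'S LETTERS — the truncated continued `(χ₁, χ₂)`-Eisenstein family is `L²`-holomorphic off its pole set, at every level

Track B ∕ K2-LIT, crux h413 = `stmt-HodgeConjecture-24833`, route of record `HCCMUnconditional`; cell `hodgecm-mathlib`, R90-TF section S8 «ContSpec-n½» — the hCONT letter shared by
the (R)′ road (★ p863731 `res_midBlock_le_residual_of_letters'''`, binder `hCONT`) and the (V) road (★ p863385, rows (i′)).  Prover seat `hodgecm-mathlib-K2E1-p10` (g5), deal S8-R182 (B)
«(C2) → p10».  THEOREMS ONLY (no `def`, no `instance`, no notation, no named-fact hypothesis, no `sorry`; default heartbeats); lane `--supports stmt-HodgeConjecture-24833 --as helper`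
(count-neutral).  CLOSES NO SOCKET.  HYPOTHESIS-FIRST twin of ★ p863548 `locally_bounded_of_core_letters_cm_three` (K2E1-p15): the inputs are the per-ball letters of ★
`chiEisenstein_meromorphic_exports_core_of_packages_cm_three_of_eigen` (`n₀ := 1`, weight `n + 4`; the Bernstein–Lapid ball data `η h a κ TX ŝ U vX` with their clauses in the ŝ-currency
of ★ row 6 EIGEN's `hCD`) together with the core's OUTPUT clauses by name (`hPc`, the cover clause `hUcov` :100, (E5) `hE5` :104, (E1) `hE2`); the sequel (C2b) re-runs the exports
heads and feeds this file ONCE (its `hC3` discharged by K2E1-p16's (C3) theorem together with §1 and the core's `hPcd hPre hEdiff hEcont` + ★ `_with_bound`'s `hEbd`).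

THE MATHEMATICS [BernsteinLapid2019, Thm 2.3, §4 Claims 4–5 (p. 10); MoeglinWaldspurger1995, I.2.13, II.1.5, IV.1.9–IV.1.11, IV.2.3].  Fix `T ≥ 1`.  Off the pole set `P` (closed,
co-discrete, inside `{Re ≤ 2}`) every point `z₀` lies either on the Godement tube `{2 < Re}`, where `[Λ^T E(f_z^φ)]` is an `L²`-holomorphic family (★ (α′), letter-free) and `Ẽ = E(f^φ)`
(E1), or in the holomorphy set `U_n` of the ball `D_n`, `n = max 1 ⌈|z₀|⌉` (the core's cover clause); there ★ (C1) gives `T₀(n) ≥ 1` and an `L²`-holomorphic `Fam_n` with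
`Fam_n z = [Λ^{T₀(n)} Ẽ(z)]` on `U_n ∖ P` (OPERATOR ROAD: `ŝ_j⁻¹ • (A(T_j vX_n) + K_j vX_n)`), and the LEVEL-CHANGE letter `hC3` — «`[Λ^{T′}Ẽ(z)] − [Λ^{T}Ẽ(z)]` is `L²`-holomorphic on
open subsets of `Pᶜ`» (the band function `𝟙_{T<w₁≤T′}·Ẽ(z)_B` at the top representative; K2E1-p16's (C3)) — moves `T₀(n)` to `T`; the local families glue (★ `exists_differentiableOn_of_local_ae_eq_within`:
two `L²` classes a.e. equal to the same function coincide).  §1 supplies the left-`G(F)`-invariance of `Ẽ(z)` OFF `P` that (C3) reads: automorphy on the tube (★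
`eisensteinSeriesU_flatSectionU_rational_mul`, `χ₂` automorphic) propagated by the identity theorem over `Pᶜ`, which is preconnected (`P` countable ★ `countable_of_codiscrete`, ★
`isPreconnected_convex_diff_of_countable`).
* §1 `continued_arithmetic_mul_of_core_cm_three` — `∀ z ∉ P, ∀ γ ∈ G(F), ∀ x, Ẽ(z)(γx) = Ẽ(z)(x)`.
* §2 HEAD **`truncatedFamily_of_core_letters_cm_three`** — (E6) `∀ T : ℝ≥0, 1 ≤ T → ∃ Fam : ℂ → Lp ℂ 2 μ, DifferentiableOn ℂ Fam Pᶜ ∧ ∀ z ∉ P, ⇑(Fam z) =ᵐ[μ] quotFun (truncation ν 𝓕 T (Ec z))`,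
  modulo the ONE letter `hC3`.
HONEST LABEL: HC_CM is proved only modulo the 7 printed citations (2 remaining named inputs: hLiu418 = `stmt-HodgeConjecture-24832`, h413 = `stmt-HodgeConjecture-24833`) until rung 0
closes; count-neutral helper, closes no socket; conditional on the core letters it is fed and on `hC3`.

## References
* [BernsteinLapid2019] J. Bernstein, E. Lapid, *On the meromorphic continuation of Eisenstein series*, J. AMS 37 (2024) (arXiv:1911.02342), Thm 2.3, §4 Claims 4–5 (p. 10).
* [MoeglinWaldspurger1995] C. Mœglin, J.-L. Waldspurger, *Spectral decomposition and Eisenstein series* (1995), I.2.13, II.1.5, IV.1.9–IV.1.11, IV.2.3.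
* [Conway1978] J. B. Conway, *Functions of One Complex Variable* (1978), IV §3 (identity theorem).
-/

set_option autoImplicit false
-- the mandated namespace repeats `HodgeConjecture.HodgeConjecture`, as in every `Theorems/*.lean` of this sub-problem
set_option linter.dupNamespace false

noncomputable section

open MeasureTheory MeasureTheory.Measure Set NumberField IsDedekindDomain Filter Topology Metric
open scoped NNReal ENNReal ComplexConjugate
open Literature.MeasureTheory.Group Literature.NumberTheory
open Literature.NumberTheory.Automorphic Literature.NumberTheory.Automorphic.UnitaryGroup AdelicGroupData
open Literature.NumberTheory.Automorphic.Arthur2013.Leaves.TECR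
open Literature.NumberTheory.GaloisRepresentations (HeckeCharacter)
open Summit.HodgeConjecture.HodgeConjecture.Cruxes.H413.K2E1BorelEisensteinU
open Summit.HodgeConjecture.HodgeConjecture.Cruxes.H413.K2E1BLBorelSpacesU2Defs
open Summit.HodgeConjecture.HodgeConjecture.Cruxes.H413.K2E1BLBorelOperatorsU2Defs
open Summit.HodgeConjecture.HodgeConjecture.Cruxes.H413.K2E1CharacterEisensteinU3PairDefs (IsChiSectionPair)
open Summit.HodgeConjecture.HodgeConjecture.Cruxes.H413.K2E1ChiTruncatedFamilyCMThree (exists_truncatedFamily_cm_three_of_eigen)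
open Summit.HodgeConjecture.HodgeConjecture.Cruxes.H413.K2E1ChiEisensteinPairTruncationTubeCMThree (exists_toLp_truncation_differentiableOn_pair_cm_three_free)
open Summit.HodgeConjecture.HodgeConjecture.Cruxes.H413.K2E1ConvexDiffCountableConnected (isPreconnected_convex_diff_of_countable countable_of_codiscrete)
open Literature.Topology.Euclidean (one_lt_rank_real_complex)
open Summit.HodgeConjecture.HodgeConjecture.Cruxes.H413.K2E1MaassSelbergFamilyCMTwo (exists_differentiableOn_of_local_ae_eq_within)

namespace Summit.HodgeConjecture.HodgeConjecture.Cruxes.H413.K2E1ChiTruncatedFamilyOfCoreLettersCMThree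

variable (L : Type) [Field L] [NumberField L] [IsCMField L]
  [MeasurableSpace (quasiSplit (↥(maximalRealSubfield L)) L (IsCMField.complexConj L) 3).Adelic] [BorelSpace (quasiSplit (↥(maximalRealSubfield L)) L (IsCMField.complexConj L) 3).Adelic]

/-! ## §1 Left-`G(F)`-invariance of the continued family off the pole set -/

omit [MeasurableSpace (quasiSplit (↥(maximalRealSubfield L)) L (IsCMField.complexConj L) 3).Adelic] [BorelSpace (quasiSplit (↥(maximalRealSubfield L)) L (IsCMField.complexConj L) 3).Adelic] in
/-- **THE CONTINUED FAMILY IS LEFT-`G(F)`-INVARIANT OFF ITS POLE SET**: for a `(χ₁, χ₂)`-pair section `φ` with `χ₂` automorphic and a continued family `Ec` holomorphic (in `z`, per `g`)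
on `Pᶜ` with `P` closed, without accumulation points, and (E1) `Ec z = E(f_z^φ)` on `{2 < Re}`: `Ec z (γ x) = Ec z x` for all `z ∉ P`, `γ ∈ G(F)`, `x` — the automorphy of the series on the
tube (★ `eisensteinSeriesU_flatSectionU_rational_mul` ∘ ★ `IsChiSectionPair.toAdelic_mul`) propagated by the identity theorem over the preconnected `Pᶜ = ℂ ∖ P` (`P` countable ★
`countable_of_codiscrete`; ★ `isPreconnected_convex_diff_of_countable`). [cite: MoeglinWaldspurger1995, II.1.5, IV.1.11] [cite: Conway1978, IV §3] -/
theorem continued_arithmetic_mul_of_core_cm_three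
    {χ₁ : HeckeCharacter L} {χ₂ : ↥(TorusDict.torus (IsCMField.complexConj L)) →ₜ* ℂˣ} (hχ₂ : TorusDict.IsAutomorphic (IsCMField.complexConj L) χ₂)
    {φ : (quasiSplit (↥(maximalRealSubfield L)) L (IsCMField.complexConj L) 3).Adelic → ℂ} (hφ : IsChiSectionPair χ₁ χ₂ φ)
    {Ec : ℂ → (quasiSplit (↥(maximalRealSubfield L)) L (IsCMField.complexConj L) 3).Adelic → ℂ} {P : Set ℂ} (hPc : IsClosed P) (hPcd : ∀ z₀ : ℂ, ∀ᶠ s in 𝓝[≠] z₀, s ∉ P)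
    (hPre : ∀ z ∈ P, z.re ≤ 2) (hEdiff : ∀ g, DifferentiableOn ℂ (fun z => Ec z g) Pᶜ) (hE2 : ∀ z : ℂ, 2 < z.re → Ec z = eisensteinSeriesU (flatSectionU φ z)) :
    ∀ z : ℂ, z ∉ P → ∀ (γ : (quasiSplit (↥(maximalRealSubfield L)) L (IsCMField.complexConj L) 3).arithmeticSubgroup) (x : (quasiSplit (↥(maximalRealSubfield L)) L (IsCMField.complexConj L) 3).Adelic),
      Ec z ((γ : (quasiSplit (↥(maximalRealSubfield L)) L (IsCMField.complexConj L) 3).Adelic) * x) = Ec z x := by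
  intro z hz γ x
  -- `γ = toAdelic γ₀`; automorphy of the series on the tube
  obtain ⟨γ₀, hγ₀⟩ := MonoidHom.mem_range.1 γ.2
  have hinv : ∀ w : ℂ, eisensteinSeriesU (flatSectionU φ w) ((γ : (quasiSplit (↥(maximalRealSubfield L)) L (IsCMField.complexConj L) 3).Adelic) * x) = eisensteinSeriesU (flatSectionU φ w) x := fun w => by
    rw [← hγ₀]
    exact eisensteinSeriesU_flatSectionU_rational_mul (hφ.toAdelic_mul hχ₂) w γ₀ x
  -- the difference is holomorphic on the preconnected `Pᶜ` and vanishes on the open tube `{2 < Re} ⊆ Pᶜ`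
  set F : ℂ → ℂ := fun w => Ec w ((γ : (quasiSplit (↥(maximalRealSubfield L)) L (IsCMField.complexConj L) 3).Adelic) * x) - Ec w x with hF
  have hFan : AnalyticOnNhd ℂ F Pᶜ := ((hEdiff _).sub (hEdiff x)).analyticOnNhd hPc.isOpen_compl
  have hPconn : IsPreconnected Pᶜ := by
    rw [Set.compl_eq_univ_sdiff]
    exact isPreconnected_convex_diff_of_countable one_lt_rank_real_complex convex_univ isOpen_univ (countable_of_codiscrete hPcd)
  have h3P : (3 : ℂ) ∈ Pᶜ := fun h3 => by have := hPre 3 h3; norm_num at this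
  have hF3 : F =ᶠ[𝓝 (3 : ℂ)] 0 := by
    have hopen : IsOpen {w : ℂ | 2 < w.re} := isOpen_lt continuous_const Complex.continuous_re
    filter_upwards [hopen.mem_nhds (show (2 : ℝ) < (3 : ℂ).re by norm_num)] with w hw
    simp only [hF, Pi.zero_apply, hE2 w hw, hinv w, sub_self]
  have hzero := hFan.eqOn_zero_of_preconnected_of_eventuallyEq_zero hPconn h3P hF3 hz
  simp only [hF, Pi.zero_apply, sub_eq_zero] at hzero
  exact hzero

/-! ## §2 HEAD: the truncated continued family is `L²`-holomorphic off `P`, at every level `T ≥ 1` -/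

/-- **(E6) FROM THE CORE'S LETTERS — `∀ T ≥ 1, ∃ Fam : ℂ → L²(𝔛, μ), DifferentiableOn ℂ Fam Pᶜ ∧ ∀ z ∉ P, Fam z =ᵐ[μ] quotFun (Λ^T (Ec z))`.**  Inputs: the structural measures of ★ X1_χ
(`μ` automorphic; `ν_G` Haar, inversion-invariant, s-finite; `ν` Haar on `N(𝔸)`, right- and inversion-invariant; `𝓕` a fundamental domain of compact closure and non-zero measure;
covering weight `β`; unfolded s-finite `μZ`); the pair section (`χ₂` automorphic, `φ` a continuous bounded `(χ₁, χ₂)`-section — for the tube ★ (α′) and §1); the per-ball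
Bernstein–Lapid letters for `n ≥ 1` in ŝ-currency (`η h a κ TX ŝ U vX` with `hη hdef hhc hhs hŝ hcov ha hκ hΩ hTX hUo hUD hvXd` — ★ row 6 EIGEN's `hCD` clauses and the ball packages);
the core's output clauses (`hPc`, cover `hUcov` :100, (E1) `hE2`, (E5) `hE5` :104); and the LEVEL-CHANGE letter `hC3` («on open `D ⊆ Pᶜ`, an `L²`-holomorphic family representing `Λ^{T₁}(Ec ·)` yields one representing `Λ^{T₂}(Ec ·)`, any
`T₁, T₂ ≥ 1`», K2E1-p16's (C3) `exists_L2Family_truncation_levelChange_cm_three` — the sequel (C2b) discharges it from p16's theorem with §1 and the core's `hEdiff hEcont hPcd hPre`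
+ ★ `_with_bound`'s `hEbd`).  Proof: module docstring
(per ball ★ (C1), level change `hC3`, tube ★ (α′) + (E1), glue ★). [cite: BernsteinLapid2019, Thm 2.3 and §4 Claims 4–5 (p. 10)] [cite: MoeglinWaldspurger1995, IV.1.9–IV.1.11, IV.2.3] -/
theorem truncatedFamily_of_core_letters_cm_three
    -- structural letters: the measures (as ★ X1_χ ∕ ★ (C1))
    (μ : Measure (quasiSplit (↥(maximalRealSubfield L)) L (IsCMField.complexConj L) 3).automorphicQuotient) [(quasiSplit (↥(maximalRealSubfield L)) L (IsCMField.complexConj L) 3).IsAutomorphicMeasure μ]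
    (νG : Measure (quasiSplit (↥(maximalRealSubfield L)) L (IsCMField.complexConj L) 3).Adelic) [νG.IsHaarMeasure] [νG.IsInvInvariant] [SFinite νG]
    (ν : Measure ↥(adelicUnipotent (↥(maximalRealSubfield L)) L (IsCMField.complexConj L) 3)) [ν.IsHaarMeasure] [ν.IsMulRightInvariant] [ν.IsInvInvariant]
    {𝓕 : Set ↥(adelicUnipotent (↥(maximalRealSubfield L)) L (IsCMField.complexConj L) 3)}
    (h𝓕N : IsFundamentalDomain ↥(rationalUnipotent (↥(maximalRealSubfield L)) L (IsCMField.complexConj L) 3) 𝓕 ν) (h𝓕c : IsCompact (closure 𝓕)) (h𝓕₀ : ν 𝓕 ≠ 0)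
    {β : (quasiSplit (↥(maximalRealSubfield L)) L (IsCMField.complexConj L) 3).Adelic → ℝ≥0∞}
    (hβ : IsCoveringWeight ↥((arithmeticBorel (↥(maximalRealSubfield L)) L (IsCMField.complexConj L) 3).map (quasiSplit (↥(maximalRealSubfield L)) L (IsCMField.complexConj L) 3).arithmeticSubgroup.subtype) β)
    {μZ : Measure (borelQuotient (↥(maximalRealSubfield L)) L (IsCMField.complexConj L) 3)} [SFinite μZ]
    (hμZ : ∀ f : borelQuotient (↥(maximalRealSubfield L)) L (IsCMField.complexConj L) 3 → ℝ≥0∞, Measurable f → ∫⁻ z, f z ∂μZ = ∫⁻ g, β g * f (toBorelQuotient (↥(maximalRealSubfield L)) L (IsCMField.complexConj L) 3 g) ∂νG)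
    -- the pair section
    {χ₁ : HeckeCharacter L} {χ₂ : ↥(TorusDict.torus (IsCMField.complexConj L)) →ₜ* ℂˣ} (hχ₂ : TorusDict.IsAutomorphic (IsCMField.complexConj L) χ₂)
    {φ : (quasiSplit (↥(maximalRealSubfield L)) L (IsCMField.complexConj L) 3).Adelic → ℂ} (hφ : IsChiSectionPair χ₁ χ₂ φ) (hφc : Continuous φ) {Mφ : ℝ} (hφM : ∀ x, ‖φ x‖ ≤ Mφ)
    -- the per-ball Bernstein–Lapid letters (balls `D_n = ball 0 (n+2)`, weight `n + 4`, `1 ≤ n`), ŝ-currency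
    {I : ℕ → Type} [∀ n, Fintype (I n)] (η : (n : ℕ) → I n → GL (Fin 3) (AdeleRing (𝓞 L) L) → ℝ)
    (h : (n : ℕ) → I n → (quasiSplit (↥(maximalRealSubfield L)) L (IsCMField.complexConj L) 3).Adelic → ℂ) (a : ℕ → ℝ≥0) (κ : (n : ℕ) → I n → ℝ≥0)
    (TX : (n : ℕ) → I n → HX (↥(maximalRealSubfield L)) L (IsCMField.complexConj L) 3 (n + 4) μ →L[ℂ] HX (↥(maximalRealSubfield L)) L (IsCMField.complexConj L) 3 (n + 4) μ)
    (ŝ : (n : ℕ) → I n → ℂ → ℂ) (U : ℕ → Set ℂ) (vX : (n : ℕ) → ℂ → HX (↥(maximalRealSubfield L)) L (IsCMField.complexConj L) 3 (n + 4) μ)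
    (hη : ∀ n i, IsTestFunctionGL 3 L (η n i))
    (hdef : ∀ n i, h n i = fun y : (quasiSplit (↥(maximalRealSubfield L)) L (IsCMField.complexConj L) 3).Adelic => orbitalSmoothing νG (fun x : (quasiSplit (↥(maximalRealSubfield L)) L (IsCMField.complexConj L) 3).Adelic => ((η n i (adelicVal (↥(maximalRealSubfield L)) L (IsCMField.complexConj L) 3 ((StdForm.antidiagonal 3).over L) x) : ℝ) : ℂ)) (fun x : (quasiSplit (↥(maximalRealSubfield L)) L (IsCMField.complexConj L) 3).Adelic => ((η n i (adelicVal (↥(maximalRealSubfield L)) L (IsCMField.complexConj L) 3 ((StdForm.antidiagonal 3).over L) x) : ℝ) : ℂ)) y)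
    (hhc : ∀ n i, Continuous (h n i)) (hhs : ∀ n i, HasCompactSupport (h n i))
    (hŝ : ∀ n i, Differentiable ℂ (ŝ n i)) (hcov : ∀ n : ℕ, 1 ≤ n → ∀ z ∈ Metric.ball (0 : ℂ) (n + 2), ∃ i, (ŝ n i z) ≠ 0)
    (ha : ∀ n, 0 < a n) (hκ : ∀ n i, 1 ≤ κ n i)
    (hΩ : ∀ n i, ∀ z : borelQuotient (↥(maximalRealSubfield L)) L (IsCMField.complexConj L) 3, ∀ y ∈ tsupport (h n i), borelQuotHeight (↥(maximalRealSubfield L)) L (IsCMField.complexConj L) 3 z ≤ κ n i * borelQuotHeight (↥(maximalRealSubfield L)) L (IsCMField.complexConj L) 3 (rightShift (↥(maximalRealSubfield L)) L (IsCMField.complexConj L) 3 y z))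
    (hTX : ∀ n i, ∀ u : HX (↥(maximalRealSubfield L)) L (IsCMField.complexConj L) 3 (n + 4) μ, (TX n i u : (quasiSplit (↥(maximalRealSubfield L)) L (IsCMField.complexConj L) 3).automorphicQuotient → ℂ) =ᵐ[μ.withDensity fun x => (((supHeight (↥(maximalRealSubfield L)) L (IsCMField.complexConj L) 3 x)⁻¹ ^ (2 * (n + 4)) : ℝ≥0) : ℝ≥0∞)]
      fun ξ => ∫ y, h n i y * (u : (quasiSplit (↥(maximalRealSubfield L)) L (IsCMField.complexConj L) 3).automorphicQuotient → ℂ) (y⁻¹ • ξ) ∂νG)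
    (hUo : ∀ n : ℕ, 1 ≤ n → IsOpen (U n)) (hUD : ∀ n : ℕ, 1 ≤ n → U n ⊆ Metric.ball (0 : ℂ) (n + 2)) (hvXd : ∀ n : ℕ, 1 ≤ n → DifferentiableOn ℂ (vX n) (U n))
    -- the core's output clauses (★ X2_χ core, `n₀ := 1`): the pole set, the cover, (E1), (E5)
    {Ec : ℂ → (quasiSplit (↥(maximalRealSubfield L)) L (IsCMField.complexConj L) 3).Adelic → ℂ} {P : Set ℂ} (hPc : IsClosed P)
    (hUcov : ∀ z : ℂ, z ∉ P → 2 < z.re ∨ (z ∈ U (max 1 ⌈‖z‖⌉₊) ∧ z ∈ U (max 1 (⌈‖z‖⌉₊ + 1))))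
    (hE2 : ∀ z : ℂ, 2 < z.re → Ec z = eisensteinSeriesU (flatSectionU φ z))
    (hE5 : ∀ g (n : ℕ), 1 ≤ n → ∀ j, ∀ z ∈ U n, z ∉ P → (ŝ n j z) ≠ 0 →
      Ec z g = (ŝ n j z)⁻¹ * ∫ y, h n j y * ((vX n z : HX (↥(maximalRealSubfield L)) L (IsCMField.complexConj L) 3 (n + 4) μ) : (quasiSplit (↥(maximalRealSubfield L)) L (IsCMField.complexConj L) 3).automorphicQuotient → ℂ) ((quasiSplit (↥(maximalRealSubfield L)) L (IsCMField.complexConj L) 3).toAutomorphicQuotient (g * y)⁻¹) ∂νG)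
    -- THE LEVEL-CHANGE LETTER (C3) (K2E1-p16's `exists_L2Family_truncation_levelChange_cm_three`, EITHER order of the levels), read on open subsets of `Pᶜ`
    (hC3 : ∀ (D : Set ℂ), IsOpen D → D ⊆ Pᶜ → ∀ (T₁ T₂ : ℝ≥0), 1 ≤ T₁ → 1 ≤ T₂ →
      (∃ Fam : ℂ → Lp ℂ 2 μ, DifferentiableOn ℂ Fam D ∧ ∀ z ∈ D, ((Fam z : Lp ℂ 2 μ) : (quasiSplit (↥(maximalRealSubfield L)) L (IsCMField.complexConj L) 3).automorphicQuotient → ℂ) =ᵐ[μ]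
        (quasiSplit (↥(maximalRealSubfield L)) L (IsCMField.complexConj L) 3).quotFun (truncation ν 𝓕 T₁ (Ec z))) →
      ∃ Fam' : ℂ → Lp ℂ 2 μ, DifferentiableOn ℂ Fam' D ∧ ∀ z ∈ D, ((Fam' z : Lp ℂ 2 μ) : (quasiSplit (↥(maximalRealSubfield L)) L (IsCMField.complexConj L) 3).automorphicQuotient → ℂ) =ᵐ[μ]
        (quasiSplit (↥(maximalRealSubfield L)) L (IsCMField.complexConj L) 3).quotFun (truncation ν 𝓕 T₂ (Ec z))) :
    ∀ T : ℝ≥0, 1 ≤ T → ∃ Fam : ℂ → Lp ℂ 2 μ, DifferentiableOn ℂ Fam Pᶜ ∧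
      ∀ z : ℂ, z ∉ P → ((Fam z : Lp ℂ 2 μ) : (quasiSplit (↥(maximalRealSubfield L)) L (IsCMField.complexConj L) 3).automorphicQuotient → ℂ) =ᵐ[μ]
        (quasiSplit (↥(maximalRealSubfield L)) L (IsCMField.complexConj L) 3).quotFun (truncation ν 𝓕 T (Ec z)) := by
  intro T hT
  refine exists_differentiableOn_of_local_ae_eq_within _ fun z₀ (hz₀ : z₀ ∈ Pᶜ) => ?_
  rcases hUcov z₀ hz₀ with htube | ⟨hzU, -⟩
  · -- ON THE TUBE: ★ (α′) for the pair section at level `T`, and (E1)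
    obtain ⟨Fam, hFd, hFam⟩ := exists_toLp_truncation_differentiableOn_pair_cm_three_free L ν h𝓕N h𝓕c hχ₂ hφ hφc hφM hT μ
    refine ⟨{z : ℂ | 2 < z.re}, (isOpen_lt continuous_const Complex.continuous_re).mem_nhds htube, Fam, hFd.mono inter_subset_left, fun z hz => ?_⟩
    rw [hE2 z hz.1]
    exact hFam z hz.1
  · -- IN THE BALL `D_n`, `n := max 1 ⌈‖z₀‖⌉₊`: ★ (C1) on `U_n ∖ P`, then the level change `hC3`
    set n : ℕ := max 1 ⌈‖z₀‖⌉₊ with hn_def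
    have hn : 1 ≤ n := le_max_left _ _
    obtain ⟨T₀, hT₀, Fam, hFd, hFam⟩ := exists_truncatedFamily_cm_three_of_eigen L μ νG ν h𝓕N h𝓕c h𝓕₀ hβ hμZ n (η n) (h n) (a n) (κ n) (TX n) (U n) (vX n) (ŝ n) (hŝ n)
      (hη n) (hdef n) (fun i => ⟨hhc n i, hhs n i⟩) (hcov n hn) (ha n) (hκ n) (hΩ n) (hTX n) (hUo n hn) (hUD n hn) (hvXd n hn) Ec P
      (fun j z hzU hzP hj g => hE5 g n hn j z hzU hzP hj)
    have hDo : IsOpen (U n \ P) := (hUo n hn).sdiff hPc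
    have hVD : U n ∩ Pᶜ ⊆ U n \ P := fun z hz => ⟨hz.1, hz.2⟩
    -- the level change `T₀ ↦ T` on `U_n ∖ P` (letter `hC3`)
    obtain ⟨Fam', hFd', hFam'⟩ := hC3 (U n \ P) hDo (fun z hz => hz.2) T₀ T hT₀ hT ⟨Fam, hFd, hFam⟩
    exact ⟨U n, (hUo n hn).mem_nhds hzU, Fam', hFd'.mono hVD, fun z hz => hFam' z (hVD hz)⟩

end Summit.HodgeConjecture.HodgeConjecture.Cruxes.H413.K2E1ChiTruncatedFamilyOfCoreLettersCMThree

end
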